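import Literature.AnabelianGeometry.AbsoluteAnabelian.AbsTopIII.KummerFaithfulFGExtensionProofs
import Literature.AnabelianGeometry.AbsoluteAnabelian.AbsTopIII.KummerFaithfulNumberFieldProofs
import HarnessLib

/-!
# [AbsTopIII] Rmk. 1.5.4 (i)+(ii) at the global base: in a finitely generated field over a number field,
# a nonzero element with `n`-th roots for every `n ≥ 1` equals `1` (PROOF-ONLY corollaries)

S. Mochizuki, *Topics in Absolute Anabelian Geometry III*, §1, Remark 1.5.4, author's manuscript p. 33–34
([AbsTopIII] Rmk 1.5.4 (i)(ii) pp.33–34): (i) "every sub-`p`-adic field [e.g. a number field] is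
Kummer-faithful"; (ii) "every finitely generated extension of a [...] torally Kummer-faithful field is itself
[...] torally Kummer-faithful", the torus case being "an easy consequence of the elementary theory of discrete
valuations"; with Def. 1.5 (a) p. 32 "`⋂_N N · A = {0}`" and Rmk. 1.5.3 (i) p. 33 "it suffices to show that
`⋂_N (k^×)^N = {1}`".

Both remarks are THEOREMS in the tree: `isKummerFaithful_of_numberField` (`KummerFaithfulNumberFieldProofs.lean`,
abc-iut-f-070/f-083/f-085 lineage) and `Rmk_1_5_4_ii_holds` (`KummerFaithfulFGExtensionProofs.lean`, abc-iut-L4-t17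
over abc-iut-L4-t1's statements).  This
PROOF-ONLY file (no `def`, no `instance`; abc-iut-w4-d050 gen 5) records their composite in the elementary
shapes consumers quote — the FUNCTION-FIELD ANALOGUE of the number-field lemma
`Literature.NumberTheory.NumberFields.eq_one_of_forall_exists_pow_eq` (`InfinitelyDivisibleEqOne.lean`):

* `isTorallyKummerFaithful_of_essFiniteType_numberField`, `divisibleElementsTrivial_units_of_essFiniteType_numberField`
  — a field essentially of finite type (= finitely generated as a field, Mathlib `IntermediateField.fg_top_iff`)
  over a number field is torally Kummer-faithful; in particular `⋂_N (E^×)^N = {1}`;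
* `eq_one_of_forall_exists_pow_eq_of_essFiniteType` — element form: `a ≠ 0`, `∀ n ≥ 1, ∃ b, b ^ n = a` ⟹ `a = 1`;
* `eq_one_of_forall_exists_pow_eq_of_finite_adjoin`, `…_of_finite_adjoin_simple` — the same for a field finite
  over `k(s)` (`s` a finite set) resp. over a simple extension `k⟮t⟯` — the function field of a curve over a
  number field when `t` is transcendental (transcendence is not needed);
* `eq_one_of_fixed_of_forall_exists_fixed_pow_eq` — GALOIS-ACTION form: for a group `Γ` acting on a field `K`
  of characteristic zero by ring automorphisms and a subgroup `H ≤ Γ` whose fixed elements lie in a subfield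
  finitely generated over `ℚ`, an `H`-fixed `a ≠ 0` admitting `H`-fixed `n`-th roots for all `n` equals `1`
  (the shape of the Kummer-injectivity law "(iv) `hdiv`" of the cell's [IUTchI] Ex. 5.1 (v) field-level
  closers, consumed in `Literature/IUT/HodgeTheaters/`).

Classical; nothing here bears on the disputed parts of IUT; no side is taken on [IUTchIII] Cor. 3.12.
-/

namespace Literature.AnabelianGeometry.AbsoluteAnabelian.AbsTopIII

open IntermediateField

/-- **A finitely generated field over a number field is torally Kummer-faithful** ([AbsTopIII] Rmk. 1.5.4
(i) for the number field, (ii) for the finitely generated extension): composite of the tree's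
`isKummerFaithful_of_numberField` and `Rmk_1_5_4_ii_holds`.
[cite: MochizukiAbsTopIII2015, Rmk 1.5.4 (i)(ii) pp.33–34] -/
theorem isTorallyKummerFaithful_of_essFiniteType_numberField (k : Type) [Field k] [NumberField k]
    (E : Type) [Field E] [Algebra k E] [Algebra.EssFiniteType k E] : IsTorallyKummerFaithful E :=
  Rmk_1_5_4_ii_holds k E (IntermediateField.fg_top k E)
    (isKummerFaithful_of_numberField k).isTorallyKummerFaithful

/-- **`⋂_N (E^×)^N = {1}` for a finitely generated field `E` over a number field** (Def. 1.5 (a) for the torus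
`𝔾_m` over `E` itself). [cite: MochizukiAbsTopIII2015, Rmk 1.5.4 (ii) p.34] -/
theorem divisibleElementsTrivial_units_of_essFiniteType_numberField (k : Type) [Field k] [NumberField k]
    (E : Type) [Field E] [Algebra k E] [Algebra.EssFiniteType k E] : DivisibleElementsTrivial Eˣ :=
  (isTorallyKummerFaithful_of_essFiniteType_numberField k E).units E (Module.Finite.self E)

/-- **Element form**: in a field `E` finitely generated over a number field `k`, a nonzero `a` admitting an
`n`-th root in `E` for every `n ≥ 1` equals `1`. [cite: MochizukiAbsTopIII2015, Rmk 1.5.4 (ii) p.34] -/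
theorem eq_one_of_forall_exists_pow_eq_of_essFiniteType (k : Type) [Field k] [NumberField k]
    {E : Type} [Field E] [Algebra k E] [Algebra.EssFiniteType k E]
    {a : E} (ha : a ≠ 0) (h : ∀ n : ℕ, 0 < n → ∃ b : E, b ^ n = a) : a = 1 := by
  have hD := divisibleElementsTrivial_units_of_essFiniteType_numberField k E
  have h1 : Units.mk0 a ha = 1 := by
    refine hD.eq_one_of_forall_exists_pow _ fun n hn => ?_
    obtain ⟨b, hb⟩ := h n hn
    have hb0 : b ≠ 0 := by
      rintro rfl
      exact ha (by rw [← hb, zero_pow (Nat.pos_iff_ne_zero.mp hn)])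
    exact ⟨Units.mk0 b hb0, Units.ext (by rw [Units.val_pow_eq_pow_val, Units.val_mk0, Units.val_mk0, hb])⟩
  have h2 := congrArg Units.val h1
  rwa [Units.val_mk0, Units.val_one] at h2

/-- **Function-field form (finite over `k(s)`, `s` finite)**: if `E` is finite over the subfield `k(s)`
generated by a finite set `s` — e.g. the function field of a curve over the number field `k` — then a nonzero
`a ∈ E` with `n`-th roots in `E` for all `n ≥ 1` equals `1`. [cite: MochizukiAbsTopIII2015, Rmk 1.5.4 (ii) p.34] -/
theorem eq_one_of_forall_exists_pow_eq_of_finite_adjoin (k : Type) [Field k] [NumberField k]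
    {E : Type} [Field E] [Algebra k E] (s : Finset E)
    [FiniteDimensional (adjoin k (s : Set E)) E]
    {a : E} (ha : a ≠ 0) (h : ∀ n : ℕ, 0 < n → ∃ b : E, b ^ n = a) : a = 1 := by
  haveI : Algebra.EssFiniteType k (adjoin k (s : Set E)) :=
    essFiniteType_iff.mpr (fg_adjoin_finset s)
  haveI : Algebra.EssFiniteType (adjoin k (s : Set E)) E := inferInstance
  haveI : Algebra.EssFiniteType k E := Algebra.EssFiniteType.comp k (adjoin k (s : Set E)) E
  exact eq_one_of_forall_exists_pow_eq_of_essFiniteType k ha h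

/-- **Function-field form (finite over a simple extension `k⟮t⟯`)**: if `E` is finite over `k⟮t⟯` — for `t`
transcendental over the number field `k` this says `E` is the function field of a curve over `k`;
transcendence of `t` is not needed — then a nonzero `a ∈ E` with `n`-th roots in `E` for all `n ≥ 1` equals
`1`. [cite: MochizukiAbsTopIII2015, Rmk 1.5.4 (ii) p.34] -/
theorem eq_one_of_forall_exists_pow_eq_of_finite_adjoin_simple (k : Type) [Field k] [NumberField k]
    {E : Type} [Field E] [Algebra k E] (t : E) [FiniteDimensional k⟮t⟯ E]
    {a : E} (ha : a ≠ 0) (h : ∀ n : ℕ, 0 < n → ∃ b : E, b ^ n = a) : a = 1 := by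
  haveI : FiniteDimensional (adjoin k (({t} : Finset E) : Set E)) E := by
    rw [Finset.coe_singleton]
    infer_instance
  exact eq_one_of_forall_exists_pow_eq_of_finite_adjoin k ({t} : Finset E) ha h

/-- **Galois-action form** (the shape of the Kummer-injectivity law "(iv)" of the cell's [IUTchI] Ex. 5.1 (v)
field-level closers): let a group `Γ` act on a field `K` of characteristic zero by ring automorphisms and
let `H ≤ Γ` be a subgroup all of whose fixed elements lie in the subfield `ℚ(s)` generated by a FINITE set
`s ⊆ K` (e.g. `K^H` a function field of a curve over a number field).  Then an `H`-fixed `a ≠ 0` that admits,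
for every `n ≥ 1`, an `H`-fixed `n`-th root equals `1`. [cite: MochizukiAbsTopIII2015, Rmk 1.5.4 (ii) p.34] -/
theorem eq_one_of_fixed_of_forall_exists_fixed_pow_eq {Γ : Type*} [Group Γ] {K : Type} [Field K]
    [CharZero K] [MulSemiringAction Γ K] (H : Subgroup Γ) (s : Finset K)
    (hgen : ∀ a : K, (∀ h : Γ, h ∈ H → h • a = a) → a ∈ adjoin ℚ (s : Set K))
    {a : K} (ha : a ≠ 0) (_hfix : ∀ h : Γ, h ∈ H → h • a = a)
    (hroots : ∀ n : ℕ+, ∃ b : K, (∀ h : Γ, h ∈ H → h • b = b) ∧ b ^ (n : ℕ) = a) : a = 1 := by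
  set E : IntermediateField ℚ K := adjoin ℚ (s : Set K) with hE
  haveI : Algebra.EssFiniteType ℚ E := essFiniteType_iff.mpr (fg_adjoin_finset s)
  -- `a` and its `H`-fixed roots lie in `E`
  obtain ⟨b₁, hb₁, hb₁a⟩ := hroots 1
  have haE : a ∈ E := by
    have : b₁ = a := by simpa using hb₁a
    rw [← this]
    exact hgen b₁ hb₁
  have haE0 : (⟨a, haE⟩ : E) ≠ 0 := fun h0 => ha (congrArg Subtype.val h0)
  have h1 : (⟨a, haE⟩ : E) = 1 := by
    refine eq_one_of_forall_exists_pow_eq_of_essFiniteType ℚ haE0 fun n hn => ?_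
    obtain ⟨b, hb, hba⟩ := hroots ⟨n, hn⟩
    exact ⟨⟨b, hgen b hb⟩, Subtype.ext (by simpa using hba)⟩
  exact congrArg Subtype.val h1

end Literature.AnabelianGeometry.AbsoluteAnabelian.AbsTopIII
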